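import Literature.MathematicalPhysics.QuantumLattice.DysonExpansion
import Literature.MathematicalPhysics.QuantumLattice.HubbardTwoPointSource
import Mathlib.Analysis.Complex.RealDeriv
import HarnessLib

/-!
# First-order perturbation theory of Gibbs expectations: the Kubo–Duhamel linear response formula

For square complex matrices `H` ("Hamiltonian"), `V` ("perturbation") and `O` ("observable"), and
the finite-dimensional Gibbs state `⟨O⟩_{β,K} = Tr(e^{-βK} O)/Tr e^{-βK}` (`Matrix.gibbsState`):

* `Matrix.hasDerivAt_trace_gibbsWeight_add_smul_mul` — the un-normalised expectation is
  differentiable in a COMPLEX coupling with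
  `d/dg Tr(e^{-β(H+gV)} O)|₀ = -β ∫₀¹ Tr(O e^{-sβH} V e^{-(1-s)βH}) ds = -β Z (O, V)_Duh`
  (the first Dyson/Duhamel term; `trace_dysonTerm_one_mul` identifies it with the coefficient
  `Tr(E₁(1) O)` of the Dyson expansion of `DysonExpansion.lean`);
* `Matrix.hasDerivAt_partitionFn_add_smul` — `d/dg Tr e^{-β(H+gV)}|₀ = -β Tr(e^{-βH} V)`;
* **`Matrix.hasDerivAt_gibbsState_add_smul`** — the **linear response / first-order perturbation
  formula** `d/dg ⟨O⟩_{β,H+gV}|₀ = -β [(O, V)_Duh - ⟨O⟩⟨V⟩]` whenever `Z_β(H) ≠ 0` (in particular for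
  Hermitian `H`), with the Duhamel two-point function `Matrix.duhamel` of `DuhamelTwoPoint.lean`;
  `Matrix.hasDerivAt_gibbsState_add_smul_real` is the same along real couplings.

The tree had the special case `O = V = A` Hermitian, real parts (`hasDerivAt_re_gibbsState_source`,
`ApproximatingHamiltonianProofs.lean`); the general complex statement is what the Dyson expansion
of Gibbs weights linearises to. Everything is PROVED; no definition.

## References

* O. Bratteli, D. W. Robinson, *Operator Algebras and QSM II*, 2nd ed. (1997), §5.4.1
  (perturbation theory of KMS states; first-order term = Duhamel two-point function). [BratteliRobinsonII1997]
* F. J. Dyson, E. H. Lieb, B. Simon, J. Stat. Phys. 18 (1978) 335, eq. (5) (the Duhamel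
  two-point function as the second derivative of the pressure). [DLS1978]
-/

noncomputable section

open scoped Matrix.Norms.L2Operator
open MeasureTheory intervalIntegral Filter NormedSpace

namespace Matrix

variable {m : Type*} [Fintype m] [DecidableEq m]

/-! ### The first Dyson term is the Duhamel integral -/

/-- `E₁(1) = ∫₀¹ e^{uA} B e^{(1-u)A} du`. [cite: BratteliRobinsonI1987, Thm. 3.1.33] -/
theorem dysonTerm_one_one (A B : Matrix m m ℂ) :
    dysonTerm A B 1 1 = ∫ u in (0:ℝ)..1, exp (u • A) * B * exp ((1 - u) • A) := by
  rw [dysonTerm_succ, duhamelOp]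
  rfl

/-- `Tr(E₁(1) O) = ∫₀¹ Tr(e^{uA} B e^{(1-u)A} O) du`. [cite: BratteliRobinsonI1987, Thm. 3.1.33] -/
theorem trace_dysonTerm_one_mul (A B O : Matrix m m ℂ) :
    (dysonTerm A B 1 1 * O).trace = ∫ u in (0:ℝ)..1, (exp (u • A) * B * exp ((1 - u) • A) * O).trace := by
  set L : Matrix m m ℂ →L[ℂ] ℂ :=
    LinearMap.toContinuousLinearMap ((Matrix.traceLinearMap m ℂ ℂ) ∘ₗ (LinearMap.mulRight ℂ O)) with hL
  have hLapply : ∀ X : Matrix m m ℂ, L X = (X * O).trace := fun X => rfl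
  rw [dysonTerm_one_one, ← hLapply, ← L.intervalIntegral_comp_comm ((continuous_exp_smul_mul_mul_exp A B A).intervalIntegrable 0 1)]
  rfl

/-! ### Derivatives of the un-normalised expectation and of the partition function -/

/-- `e^{-β(H + gV)} = e^{A + gY}` with `A = -βH`, `Y = -βV`. [folklore] -/
theorem gibbsWeight_add_smul (β : ℝ) (H V : Matrix m m ℂ) (g : ℂ) :
    gibbsWeight β (H + g • V) = exp (-(β : ℂ) • H + g • (-(β : ℂ) • V)) := by
  rw [gibbsWeight, smul_add, smul_comm]

/-- **`d/dg Tr(e^{-β(H+gV)} O)|₀ = -β ∫₀¹ Tr(O e^{-sβH} V e^{-(1-s)βH}) ds`** (complex coupling `g`;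
Duhamel's formula and cyclicity of the trace). [cite: DLS1978, eq. (5)] -/
theorem hasDerivAt_trace_gibbsWeight_add_smul_mul (β : ℝ) (H V O : Matrix m m ℂ) :
    HasDerivAt (fun g : ℂ => (gibbsWeight β (H + g • V) * O).trace)
      (-(β : ℂ) * ∫ s in (0:ℝ)..1, (O * gibbsWeight (s * β) H * V * gibbsWeight ((1 - s) * β) H).trace) 0 := by
  set A : Matrix m m ℂ := -(β : ℂ) • H with hA
  set Y : Matrix m m ℂ := -(β : ℂ) • V with hY
  set L : Matrix m m ℂ →L[ℂ] ℂ :=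
    LinearMap.toContinuousLinearMap ((Matrix.traceLinearMap m ℂ ℂ) ∘ₗ (LinearMap.mulRight ℂ O)) with hL
  have hLapply : ∀ X : Matrix m m ℂ, L X = (X * O).trace := fun X => rfl
  have h := L.hasFDerivAt.comp_hasDerivAt (0 : ℂ) (Matrix.hasDerivAt_exp_add_smul_complex A Y 0)
  rw [zero_smul, add_zero, ← L.intervalIntegral_comp_comm ((continuous_exp_smul_mul_mul_exp A Y A).intervalIntegrable 0 1)] at h
  have hfun : (fun g : ℂ => (gibbsWeight β (H + g • V) * O).trace) = (L : Matrix m m ℂ → ℂ) ∘ fun g : ℂ => exp (A + g • Y) := by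
    funext g
    simp only [Function.comp_apply, hLapply, gibbsWeight_add_smul]
    rfl
  rw [hfun]
  refine h.congr_deriv ?_
  rw [← intervalIntegral.integral_const_mul]
  refine intervalIntegral.integral_congr fun s _ => ?_
  simp only [hLapply]
  rw [hA, hY, exp_smul_neg_smul_eq_gibbsWeight β s H, exp_smul_neg_smul_eq_gibbsWeight β (1 - s) H, Matrix.mul_smul,
    Matrix.smul_mul, Matrix.smul_mul, trace_smul, smul_eq_mul, trace_mul_cycle, ← Matrix.mul_assoc]

/-- The Gibbs weights form a one-parameter semigroup: `e^{-sβH} e^{-tβH} = e^{-(s+t)βH}`. [folklore] -/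
theorem gibbsWeight_mul_gibbsWeight (s t : ℝ) (H : Matrix m m ℂ) : gibbsWeight s H * gibbsWeight t H = gibbsWeight (s + t) H := by
  rw [gibbsWeight, gibbsWeight, gibbsWeight, ← Matrix.exp_add_of_commute _ _ (((Commute.refl H).smul_left _).smul_right _),
    ← add_smul]
  congr 1
  push_cast
  ring

/-- **`d/dg Tr e^{-β(H+gV)}|₀ = -β Tr(e^{-βH} V)`.** [cite: DLS1978, §3] -/
theorem hasDerivAt_partitionFn_add_smul (β : ℝ) (H V : Matrix m m ℂ) :
    HasDerivAt (fun g : ℂ => partitionFn β (H + g • V)) (-(β : ℂ) * (gibbsWeight β H * V).trace) 0 := by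
  have h := hasDerivAt_trace_gibbsWeight_add_smul_mul β H V 1
  simp only [Matrix.mul_one] at h
  have hfun : (fun g : ℂ => partitionFn β (H + g • V)) = fun g : ℂ => (gibbsWeight β (H + g • V)).trace := rfl
  rw [hfun]
  refine h.congr_deriv ?_
  congr 1
  have key : ∀ s : ℝ, ((1 : Matrix m m ℂ) * gibbsWeight (s * β) H * V * gibbsWeight ((1 - s) * β) H).trace = (gibbsWeight β H * V).trace := by
    intro s
    rw [Matrix.one_mul, trace_mul_cycle, gibbsWeight_mul_gibbsWeight]
    congr 3
    ring
  simp_rw [key]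
  simp

/-! ### The linear response formula -/

/-- **First-order perturbation theory / Kubo–Duhamel linear response**: if `Z_β(H) ≠ 0` then
`g ↦ ⟨O⟩_{β, H + gV}` is complex-differentiable at `0` with
`d/dg ⟨O⟩_{β,H+gV}|₀ = -β [(O, V)_Duh - ⟨O⟩_{β,H} ⟨V⟩_{β,H}]`.
[cite: BratteliRobinsonII1997, §5.4.1] -/
theorem hasDerivAt_gibbsState_add_smul (β : ℝ) {H : Matrix m m ℂ} (hZ : partitionFn β H ≠ 0) (V O : Matrix m m ℂ) :
    HasDerivAt (fun g : ℂ => gibbsState β (H + g • V) O)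
      (-(β : ℂ) * (duhamel β H O V - gibbsState β H O * gibbsState β H V)) 0 := by
  have hN := hasDerivAt_trace_gibbsWeight_add_smul_mul β H V O
  have hD := hasDerivAt_partitionFn_add_smul β H V
  have hZ0 : partitionFn β (H + (0 : ℂ) • V) ≠ 0 := by rwa [zero_smul, add_zero]
  have hq := hN.div hD hZ0
  have hfun : (fun g : ℂ => gibbsState β (H + g • V) O) =
      fun g : ℂ => (gibbsWeight β (H + g • V) * O).trace / partitionFn β (H + g • V) := by
    funext g
    rw [gibbsState_apply, div_eq_inv_mul]
  rw [hfun]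
  refine hq.congr_deriv ?_
  simp only [zero_smul, add_zero]
  rw [duhamel, gibbsState_apply, gibbsState_apply]
  set D := ∫ s in (0:ℝ)..1, (O * gibbsWeight (s * β) H * V * gibbsWeight ((1 - s) * β) H).trace
  field_simp
  ring

/-- The same along REAL couplings `t ↦ ⟨O⟩_{β, H + tV}`. [cite: BratteliRobinsonII1997, §5.4.1] -/
theorem hasDerivAt_gibbsState_add_smul_real (β : ℝ) {H : Matrix m m ℂ} (hZ : partitionFn β H ≠ 0) (V O : Matrix m m ℂ) :
    HasDerivAt (fun t : ℝ => gibbsState β (H + (t : ℂ) • V) O)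
      (-(β : ℂ) * (duhamel β H O V - gibbsState β H O * gibbsState β H V)) 0 := by
  have h := hasDerivAt_gibbsState_add_smul β hZ V O
  rw [← Complex.ofReal_zero] at h
  exact h.comp_ofReal

/-- For a Hermitian Hamiltonian the hypothesis `Z ≠ 0` holds. [folklore] -/
theorem hasDerivAt_gibbsState_add_smul_of_isHermitian (β : ℝ) {H : Matrix m m ℂ} (hH : H.IsHermitian) [Nonempty m]
    (V O : Matrix m m ℂ) :
    HasDerivAt (fun g : ℂ => gibbsState β (H + g • V) O)
      (-(β : ℂ) * (duhamel β H O V - gibbsState β H O * gibbsState β H V)) 0 :=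
  hasDerivAt_gibbsState_add_smul β (by
    rw [hH.partitionFn_eq_ofReal]
    exact_mod_cast (hH.sum_exp_pos β).ne') V O

/-- **Consistency with the Dyson expansion**: the first-order coefficient `Tr(E₁(1) O)` of the
Dyson series of `Tr(e^{-β(H+gV)} O)` (`hasSum_dyson_trace_gibbsWeight_mul`) is the derivative
`d/dg Tr(e^{-β(H+gV)} O)|₀`. [cite: BratteliRobinsonII1997, §5.4.1] -/
theorem trace_dysonTerm_one_mul_eq_deriv (β : ℝ) (H V O : Matrix m m ℂ) :
    (dysonTerm (-(β : ℂ) • H) (-(β : ℂ) • V) 1 1 * O).trace = deriv (fun g : ℂ => (gibbsWeight β (H + g • V) * O).trace) 0 := by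
  rw [(hasDerivAt_trace_gibbsWeight_add_smul_mul β H V O).deriv, trace_dysonTerm_one_mul, ← intervalIntegral.integral_const_mul]
  refine intervalIntegral.integral_congr fun s _ => ?_
  rw [exp_smul_neg_smul_eq_gibbsWeight β s H, exp_smul_neg_smul_eq_gibbsWeight β (1 - s) H, Matrix.mul_smul, Matrix.smul_mul,
    Matrix.smul_mul, trace_smul, smul_eq_mul, trace_mul_cycle, ← Matrix.mul_assoc]

end Matrix

end
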